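import Literature.Analysis.FunctionSpaces.PotentialDynamics
import HarnessLib

/-!
# Discharged fact: conservation of energy along the `N`-body Hamiltonian flow in `ℝ^d`

`Literature.Analysis.FunctionSpaces.PotentialDynamics` records as the named fact
`hamiltonianEnergy_flow_euclidean` that the Hamiltonian
`H_N(z) = ½ ∑_i |v_i|² + ∑_{i<j} Φ_ε(x_i - x_j)` (`hamiltonianEnergy`) is conserved along every
potential flow `Ψ : PotentialFlow (Euclidean.geometry d) Φ ε N` started from a good initial datum:
`H_N(Ψ_t z) = H_N(z)` for `z ∈ Ψ.good` and all `t` (Gallagher–Saint-Raymond–Texier 2013,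
arXiv:1208.5753 numbering: Part I Ch. 1 §1, Newton's equations; Part III Ch. 8 §1, the
conservation laws of the two-particle system; Ch. 10 §2, the `s`-particle Hamiltonian `E_ε` and the
"conservation of energy" identity `|H_s(t) g_s|_{ε,s,β} = |g_s|_{ε,s,β}` for the `s`-particle flow).
It is proved here (`hamiltonianEnergy_flow_euclidean_holds`) by the textbook first-integral
computation:

* positions along a Hamiltonian trajectory are differentiable with derivative the velocity
  (`IsHamiltonianTrajectory.hasDerivAt_pos_euclidean`: the integrated form
  `x_i(t) = x_i(0) + ∫₀ᵗ v_i` of `IsHamiltonianTrajectory.pos_eq` and the fundamental theorem of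
  calculus, `v_i` being differentiable hence continuous);
* the rescaled potential `Φ_ε(y) = φ(|y|/|ε|)` is even (`ShortRangePotential.scaled_neg`) and
  differentiable off the origin (`ShortRangePotential.differentiableAt_scaled`; for `ε = 0` it is
  constant), and the gradient of an even function is odd everywhere, junk values included
  (`gradient_neg_eq_neg_gradient_of_even`);
* hence, at a configuration without coincident pairs, `d/dt ½|v_i|² = ⟪v_i, F_i⟫` with
  `F_i = -∑_{j ≠ i} ∇Φ_ε(x_i - x_j)` (Newton's law `IsHamiltonianTrajectory.vel_hasDerivAt`) and
  `d/dt Φ_ε(x_i - x_j) = ⟪∇Φ_ε(x_i - x_j), v_i - v_j⟫`, and these cancel after regrouping the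
  double sum over ordered pairs into pairs `i < j` and their transposes
  (`inner_force_add_sum_inner_gradient_eq_zero`), so `t ↦ H_N(γ t)` has zero derivative
  (`IsHamiltonianTrajectory.hasDerivAt_hamiltonianEnergy_euclidean`);
* the orbit of a good point stays in the good set, which avoids coincidences
  (`PotentialFlow.mapsTo_good`, `PotentialFlow.good_subset`), so `t ↦ H_N(Ψ_t z)` is
  differentiable with zero derivative on `ℝ`, hence constant (`is_const_of_deriv_eq_zero`), and
  `Ψ_0 z = z` (`PotentialFlow.flow_zero`).

No hypothesis on `ε` is needed (`Φ_ε` depends on `|ε|` only and is constant for `ε = 0`), in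
accordance with the statement of the fact. No statement of `PotentialDynamics` is changed; this
file only adds proofs (and the small calculus lemmas above, all proved).

## What is not here

The torus analogue `hamiltonianEnergy_flow_torus` (`0 < ε < 1/2`) additionally needs the local
rigidity `reprSym ((x + a) - (y + b)) = reprSym (x - y) + (a - b)` of the minimal-image separation
on the support of `Φ_ε`; it is left as a named fact. `gradient_neg_eq_neg_gradient_of_even` and
`inner_force_add_sum_inner_gradient_eq_zero` are stated so as to be reusable there.

## References

* I. Gallagher, L. Saint-Raymond, B. Texier, *From Newton to Boltzmann: hard spheres and
  short-range potentials*, Zurich Lectures in Advanced Mathematics, EMS (2013); arXiv:1208.5753,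
  Part I Ch. 1 §1 (Hamiltonian equations of motion), Part III Ch. 8 §1 (conservation laws of the
  two-particle system), Ch. 10 §2 (the `s`-particle Hamiltonian `E_ε`, conservation of energy for
  `H_s(t)`). [GallagherSaintRaymondTexier2013]
-/

open MeasureTheory Metric Set Filter Topology
open scoped InnerProductSpace

noncomputable section

namespace Literature.Analysis.FunctionSpaces

variable {d : Type*} [Fintype d] {N : ℕ}

namespace ShortRangePotential

/-- The rescaled potential is even: `Φ_ε(-y) = Φ_ε(y)` (it is radial). [folklore] -/
theorem scaled_neg (Φ : ShortRangePotential d) (ε : ℝ) (y : EuclideanSpace ℝ d) :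
    Φ.scaled ε (-y) = Φ.scaled ε y := by
  simp [scaled_apply, smul_neg, norm_neg]

/-- The rescaled potential `Φ_ε` is differentiable away from the origin: for `ε = 0` it is the
constant `φ 0`, and for `ε ≠ 0` it is the composition of `φ`, which is `C²` on `(0, ∞)`, with
`y ↦ |y| / |ε|`, smooth off `0`. [folklore] -/
theorem differentiableAt_scaled (Φ : ShortRangePotential d) (ε : ℝ) {y : EuclideanSpace ℝ d}
    (hy : y ≠ 0) : DifferentiableAt ℝ (Φ.scaled ε) y := by
  rcases eq_or_ne ε 0 with rfl | hε
  · have h : Φ.scaled (0 : ℝ) = fun _ => Φ.φ 0 := by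
      funext x
      simp [scaled_apply]
    rw [h]
    exact differentiableAt_const _
  · have hy' : ε⁻¹ • y ≠ 0 := smul_ne_zero (inv_ne_zero hε) hy
    have hpos : 0 < ‖ε⁻¹ • y‖ := norm_pos_iff.mpr hy'
    have h1 : DifferentiableAt ℝ (fun x : EuclideanSpace ℝ d => ‖ε⁻¹ • x‖) y :=
      (differentiableAt_id.const_smul ε⁻¹).norm ℝ hy'
    have h2 : DifferentiableAt ℝ Φ.φ ‖ε⁻¹ • y‖ :=
      (Φ.differentiableOn_deriv_φ.1 _ hpos).differentiableAt (Ioi_mem_nhds hpos)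
    have h : Φ.scaled ε = Φ.φ ∘ fun x : EuclideanSpace ℝ d => ‖ε⁻¹ • x‖ := rfl
    rw [h]
    exact h2.comp y h1

end ShortRangePotential

/-- The gradient of an even function on a real Hilbert space is odd — at every point, the junk
value `0` at points of non-differentiability included (differentiability at `x` and at `-x` are
equivalent for an even function). [folklore] -/
theorem gradient_neg_eq_neg_gradient_of_even {F : Type*} [NormedAddCommGroup F]
    [InnerProductSpace ℝ F] [CompleteSpace F] {f : F → ℝ} (hf : ∀ x, f (-x) = f x) (x : F) :
    gradient f (-x) = -gradient f x := by
  have key : ∀ (y : F) (f' : F →L[ℝ] ℝ), HasFDerivAt f f' y → HasFDerivAt f (-f') (-y) := by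
    intro y f' h
    have hneg : HasFDerivAt (fun x : F => -x) (-ContinuousLinearMap.id ℝ F) (-y) :=
      (hasFDerivAt_id (-y)).neg
    have h' : HasFDerivAt f f' (-(-y)) := by rwa [neg_neg]
    have hcomp := h'.comp (-y) hneg
    have hfe : (f ∘ fun x : F => -x) = f := funext fun x => hf x
    rw [hfe, ContinuousLinearMap.comp_neg, ContinuousLinearMap.comp_id] at hcomp
    exact hcomp
  by_cases h : DifferentiableAt ℝ f x
  · have h1 : HasFDerivAt f (-(InnerProductSpace.toDual ℝ F (gradient f x))) (-x) :=
      key x _ h.hasGradientAt.hasFDerivAt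
    rw [← map_neg] at h1
    exact (hasGradientAt_iff_hasFDerivAt.mpr h1).gradient
  · have h' : ¬DifferentiableAt ℝ f (-x) := fun h' =>
      h (by simpa using (key (-x) _ h'.hasFDerivAt).differentiableAt)
    rw [gradient_eq_zero_of_not_differentiableAt h, gradient_eq_zero_of_not_differentiableAt h',
      neg_zero]

/-- Double sums over ordered pairs of distinct indices, regrouped over the pairs `i < j` together
with their transposes. [folklore] -/
private theorem sum_sum_erase_eq_sum_sum_lt {N : ℕ} (a : Fin N → Fin N → ℝ) :
    ∑ i, ∑ j ∈ Finset.univ.erase i, a i j =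
      ∑ i, ∑ j ∈ Finset.univ.filter (fun j => i < j), (a i j + a j i) := by
  have h1 : ∀ i : Fin N, ∑ j ∈ Finset.univ.erase i, a i j =
      ∑ j ∈ Finset.univ.filter (fun j => i < j), a i j +
        ∑ j ∈ Finset.univ.filter (fun j => j < i), a i j := by
    intro i
    rw [← Finset.sum_filter_add_sum_filter_not (Finset.univ.erase i) (fun j => i < j)]
    congr 1
    · refine Finset.sum_congr ?_ fun _ _ => rfl
      ext j
      simp only [Finset.mem_filter, Finset.mem_erase, Finset.mem_univ, and_true, true_and,
        and_iff_right_iff_imp]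
      exact fun h => h.ne'
    · refine Finset.sum_congr ?_ fun _ _ => rfl
      ext j
      simp only [Finset.mem_filter, Finset.mem_erase, Finset.mem_univ, and_true, true_and, not_lt]
      constructor
      · rintro ⟨hne, hle⟩
        exact lt_of_le_of_ne hle hne
      · intro h
        exact ⟨h.ne, h.le⟩
  have h2 : ∑ i, ∑ j ∈ Finset.univ.filter (fun j => j < i), a i j =
      ∑ i, ∑ j ∈ Finset.univ.filter (fun j => i < j), a j i := by
    simp only [Finset.sum_filter]
    exact Finset.sum_comm
  simp only [h1, Finset.sum_add_distrib, h2]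

/-- The algebraic identity behind conservation of energy for Newton's equations with an even pair
potential in `ℝ^d`: pairing the forces with the velocities cancels the time derivative of the
pair-interaction energy, `∑_i ⟪v_i, F_i⟫ + ∑_{i<j} ⟪∇Φ_ε(x_i - x_j), v_i - v_j⟫ = 0`
(the gradient of the even function `Φ_ε` being odd). [folklore] -/
theorem inner_force_add_sum_inner_gradient_eq_zero (Φ : ShortRangePotential d) (ε : ℝ)
    (z : FluidPDE.Config N d (EuclideanSpace ℝ d)) :
    2⁻¹ * ∑ i, 2 * ⟪z.vel i, force (FluidPDE.Euclidean.geometry d) Φ ε z i⟫_ℝ +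
      ∑ i, ∑ j ∈ Finset.univ.filter (fun j => i < j),
        ⟪gradient (Φ.scaled ε) (z.pos i - z.pos j), z.vel i - z.vel j⟫_ℝ = 0 := by
  have hodd : ∀ i j, gradient (Φ.scaled ε) (z.pos j - z.pos i) =
      -gradient (Φ.scaled ε) (z.pos i - z.pos j) := by
    intro i j
    rw [← neg_sub (z.pos i) (z.pos j)]
    exact gradient_neg_eq_neg_gradient_of_even (Φ.scaled_neg ε) _
  have h1 : ∀ i, ⟪z.vel i, force (FluidPDE.Euclidean.geometry d) Φ ε z i⟫_ℝ =
      -∑ j ∈ Finset.univ.erase i, ⟪z.vel i, gradient (Φ.scaled ε) (z.pos i - z.pos j)⟫_ℝ := by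
    intro i
    rw [force, inner_neg_right, inner_sum]
    rfl
  have h2 : ∀ i j, ⟪gradient (Φ.scaled ε) (z.pos i - z.pos j), z.vel i - z.vel j⟫_ℝ =
      ⟪z.vel i, gradient (Φ.scaled ε) (z.pos i - z.pos j)⟫_ℝ +
        ⟪z.vel j, gradient (Φ.scaled ε) (z.pos j - z.pos i)⟫_ℝ := by
    intro i j
    rw [inner_sub_right, hodd i j, inner_neg_right, real_inner_comm (z.vel i),
      real_inner_comm (z.vel j)]
    ring
  have h3 : ∑ i, ∑ j ∈ Finset.univ.erase i,
      ⟪z.vel i, gradient (Φ.scaled ε) (z.pos i - z.pos j)⟫_ℝ =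
      ∑ i, ∑ j ∈ Finset.univ.filter (fun j => i < j),
        (⟪z.vel i, gradient (Φ.scaled ε) (z.pos i - z.pos j)⟫_ℝ +
          ⟪z.vel j, gradient (Φ.scaled ε) (z.pos j - z.pos i)⟫_ℝ) :=
    sum_sum_erase_eq_sum_sum_lt fun i j => ⟪z.vel i, gradient (Φ.scaled ε) (z.pos i - z.pos j)⟫_ℝ
  simp only [h1, h2]
  rw [← h3, ← Finset.mul_sum, Finset.sum_neg_distrib]
  ring

variable {Φ : ShortRangePotential d} {ε : ℝ}

/-- Along a Hamiltonian trajectory in `ℝ^d` each position is differentiable in time with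
derivative the velocity: `ẋ_i = v_i` (the integrated form `x_i(t) = x_i(0) + ∫₀ᵗ v_i` of
`IsHamiltonianTrajectory.pos_eq`, differentiated by the fundamental theorem of calculus, the
velocity being continuous since differentiable). [folklore] -/
theorem IsHamiltonianTrajectory.hasDerivAt_pos_euclidean
    {γ : ℝ → FluidPDE.Config N d (EuclideanSpace ℝ d)}
    (hγ : IsHamiltonianTrajectory (FluidPDE.Euclidean.geometry d) Φ ε N γ) (t : ℝ) (i : Fin N) :
    HasDerivAt (fun s => (γ s).pos i) ((γ t).vel i) t := by
  have hcont : Continuous fun s => (γ s).vel i :=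
    continuous_iff_continuousAt.2 fun s => (hγ.vel_hasDerivAt s i).continuousAt
  have h : (fun s => (γ s).pos i) = fun s => (γ 0).pos i + ∫ τ in (0 : ℝ)..s, (γ τ).vel i := by
    funext s
    rw [hγ.pos_eq s i, FluidPDE.Euclidean.geometry_translate]
  rw [h]
  exact ((hcont.integral_hasStrictDerivAt 0 t).hasDerivAt).const_add _

/-- Along a Hamiltonian trajectory of the `N`-body system in `ℝ^d`, at any time at which the
configuration has no coincident pair, the Hamiltonian `H_N` has zero time derivative:
`d/dt [½ ∑ |v_i|²] = ∑_i ⟪v_i, F_i⟫` (Newton's law) and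
`d/dt Φ_ε(x_i - x_j) = ⟪∇Φ_ε(x_i - x_j), v_i - v_j⟫` (chain rule, `Φ_ε` being differentiable off
the origin), which cancel (`inner_force_add_sum_inner_gradient_eq_zero`)
(GST 2013 Part III: Ch. 8 §1 (conservation laws) for two particles, Ch. 10 §2 for `s`
particles). [cite: GallagherSaintRaymondTexier2013, Part III Ch. 8 §1 (conservation laws, display after the two-particle system) & Ch. 10 §2 (s-particle Hamiltonian E_ε; conservation of energy for H_s(t)), arXiv:1208.5753 numbering] -/
theorem IsHamiltonianTrajectory.hasDerivAt_hamiltonianEnergy_euclidean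
    {γ : ℝ → FluidPDE.Config N d (EuclideanSpace ℝ d)}
    (hγ : IsHamiltonianTrajectory (FluidPDE.Euclidean.geometry d) Φ ε N γ) {t : ℝ}
    (ht : γ t ∈ noCoincidence (FluidPDE.Euclidean.geometry d) N) :
    HasDerivAt (fun s => hamiltonianEnergy (FluidPDE.Euclidean.geometry d) Φ ε (γ s)) 0 t := by
  have hkin : HasDerivAt (fun s => FluidPDE.configEnergy (γ s))
      (2⁻¹ * ∑ i, 2 * ⟪(γ t).vel i, force (FluidPDE.Euclidean.geometry d) Φ ε (γ t) i⟫_ℝ) t := by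
    unfold FluidPDE.configEnergy
    exact HasDerivAt.const_mul _ (HasDerivAt.fun_sum fun i _ => (hγ.vel_hasDerivAt t i).norm_sq)
  have hpair : ∀ i j : Fin N, i ≠ j →
      HasDerivAt (fun s => Φ.scaled ε ((γ s).pos i - (γ s).pos j))
        ⟪gradient (Φ.scaled ε) ((γ t).pos i - (γ t).pos j), (γ t).vel i - (γ t).vel j⟫_ℝ t := by
    intro i j hij
    have hp : HasDerivAt (fun s => (γ s).pos i - (γ s).pos j) ((γ t).vel i - (γ t).vel j) t :=
      (hγ.hasDerivAt_pos_euclidean t i).fun_sub (hγ.hasDerivAt_pos_euclidean t j)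
    have hne : (γ t).pos i - (γ t).pos j ≠ 0 := ht i j hij
    have hd : DifferentiableAt ℝ (Φ.scaled ε) ((γ t).pos i - (γ t).pos j) :=
      Φ.differentiableAt_scaled ε hne
    have h := hd.hasFDerivAt.comp_hasDerivAt t hp
    rw [← inner_gradient_left] at h
    exact h
  have hpot : HasDerivAt (fun s => ∑ i, ∑ j ∈ Finset.univ.filter (fun j => i < j),
      Φ.scaled ε ((γ s).pos i - (γ s).pos j))
      (∑ i, ∑ j ∈ Finset.univ.filter (fun j => i < j),
        ⟪gradient (Φ.scaled ε) ((γ t).pos i - (γ t).pos j), (γ t).vel i - (γ t).vel j⟫_ℝ) t :=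
    HasDerivAt.fun_sum fun i _ => HasDerivAt.fun_sum fun j hj =>
      hpair i j (ne_of_lt (Finset.mem_filter.1 hj).2)
  have h := (hkin.fun_add hpot).congr_deriv
    (inner_force_add_sum_inner_gradient_eq_zero Φ ε (γ t))
  exact h

/-- **Conservation of energy along the Hamiltonian flow in `ℝ^d`** (discharge of the named fact
`hamiltonianEnergy_flow_euclidean`): for every potential flow `Ψ` on `ℝ^d`, every good initial
datum `z` and every time `t`, `H_N(Ψ_t z) = H_N(z)`. The orbit `t ↦ Ψ_t z` is a Hamiltonian
trajectory (`PotentialFlow.isTrajectory`) staying in the good set, hence off coincidences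
(`mapsTo_good`, `good_subset`), so `t ↦ H_N(Ψ_t z)` has zero derivative everywhere
(`IsHamiltonianTrajectory.hasDerivAt_hamiltonianEnergy_euclidean`) and is constant, and
`Ψ_0 z = z`. This is the conservation of energy of GST 2013 (arXiv Part III Ch. 8 §1 for two
particles; Ch. 10 §2, invariance of the weights `exp(β E_ε)` under the `s`-particle flow
`H_s(t)`). [cite: GallagherSaintRaymondTexier2013, Part III Ch. 10 §2 (s-particle Hamiltonian E_ε and the conservation-of-energy identity for the flow H_s(t)) & Ch. 8 §1 (conservation laws), arXiv:1208.5753 numbering] -/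
theorem hamiltonianEnergy_flow_euclidean_holds :
    hamiltonianEnergy_flow_euclidean (N := N) (Φ := Φ) (ε := ε) := by
  intro Ψ z hz t
  have hγ : IsHamiltonianTrajectory (FluidPDE.Euclidean.geometry d) Φ ε N fun s => Ψ.flow s z :=
    Ψ.isTrajectory z hz
  have hderiv : ∀ s, HasDerivAt
      (fun τ => hamiltonianEnergy (FluidPDE.Euclidean.geometry d) Φ ε (Ψ.flow τ z)) 0 s :=
    fun s => hγ.hasDerivAt_hamiltonianEnergy_euclidean (Ψ.good_subset (Ψ.mapsTo_good s hz))
  have hconst := is_const_of_deriv_eq_zero (fun s => (hderiv s).differentiableAt)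
    (fun s => (hderiv s).deriv) t 0
  rw [Ψ.flow_zero z hz] at hconst
  exact hconst

end Literature.Analysis.FunctionSpaces
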